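import Literature.Analysis.FluidPDE.NovackFourThirdsFourFifthsProofs
import Literature.Analysis.FluidPDE.NovackLongitudinalBalanceSteps
import Literature.Analysis.FluidPDE.NovackMatrixKernelCubicIdentity
import Literature.Analysis.FluidPDE.NovackMatrixKernelTestFieldProofs
import Literature.Analysis.FluidPDE.NovackLongitudinalBalanceProofs
import Literature.Analysis.FluidPDE.NovackBallAvgBalanceProofs
import HarnessLib

/-!
# Novack 2024, Theorem 1 (the 4/3 and 4/5 lines): the discharge

Topic: Analysis/FluidPDE. Sorry-free proof `Torus.novack2024_fourThirds_fourFifths_holds` of the named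
fact `Torus.novack2024_fourThirds_fourFifths` (`Literature.Analysis.FluidPDE.NovackScalingLaws`;
M. Novack, *Scaling laws and exact results in turbulence*, Nonlinearity 37 (2024) 095002, Thm. 1,
Euler case, lines `• = I, L`: for every weak Euler solution `(u, p)` on `[0,T] × T^d`, `d ≥ 2`, with
`u ∈ L³ ∩ C⁰_t L²_x`, `p ∈ L^{3/2}`, `u₀ ∈ L²`, and every functional `D` with the local energy
balance, the local 4/3 law and the local 4/5 law hold).

The tree now proves every printed step of Novack's §2 along his own regularisation (ball
averages): the scale-`ℓ` ball-kernel balance and its limit (`novack2024_ballAvg_balance_holds`,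
`novack2024_ballAvg_balance_tendsto_holds`, §2 Step 1), the scale-`ℓ` longitudinal balance from the
matrix-kernel cubic identity and tested momentum equation
(`novack2024_longAvg_balance_of_steps integral_matKernelFlux_mul_eq_holds IsDistributionalNSSolutionOn.matSymmTestField_identity_holds`,
§2 Step 0 and Step 2) and its limit (`novack2024_longAvg_balance_tendsto_holds`), assembled by
`novack2024_fourThirds_fourFifths_of_balances` (`NovackLongitudinalBalance`). This file records the
resulting unconditional theorem. (The companion `NovackFourThirdsFourFifthsProofs` derives the same
fact along Eyink's route from the single named fact `eyink_transverse_balance`, and proves the 4/3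
half unconditionally along Duchon–Robert's route.)

## References

* M. Novack, *Scaling laws and exact results in turbulence*, Nonlinearity 37 (2024) 095002 =
  arXiv:2310.01375, Thm. 1 and §2 (Steps 0–2), Appendix Prop. 1. [Novack2024]
* J. Duchon, R. Robert, Nonlinearity 13 (2000) 249–255, Prop. 1–2. [DuchonRobert2000]
* G. L. Eyink, Nonlinearity 16 (2003) 137–145, Thm. 1. [Eyink2003]
-/

noncomputable section

namespace Literature.Analysis.FluidPDE.Torus

variable {d : Type*} [Fintype d]

/-- **Novack 2024, Thm. 1 (Euler case, the 4/3 and 4/5 lines), discharged.** For `d ≥ 2` and every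
weak Euler solution `(u, p)` on `[0,T] × T^d` in Novack's class (`u ∈ L³ ∩ C⁰([0,T]; L²)`,
`p ∈ L^{3/2}`, `u₀ ∈ L²`), every functional `D` satisfying the local energy balance obeys the local
4/3 law and the local 4/5 law — the named fact `Torus.novack2024_fourThirds_fourFifths`, from the
tree's proofs of Novack's four scale-`ℓ` steps (`novack2024_fourThirds_fourFifths_of_balances`).
[cite: Novack2024, Thm. 1] -/
theorem novack2024_fourThirds_fourFifths_holds : novack2024_fourThirds_fourFifths (d := d) := by
  classical
  exact novack2024_fourThirds_fourFifths_of_balances novack2024_ballAvg_balance_holds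
    novack2024_ballAvg_balance_tendsto_holds
    (novack2024_longAvg_balance_of_steps integral_matKernelFlux_mul_eq_holds
      IsDistributionalNSSolutionOn.matSymmTestField_identity_holds)
    novack2024_longAvg_balance_tendsto_holds

end Literature.Analysis.FluidPDE.Torus
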